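import Summits.Ventures.HSemireg.WedgeHankelRecurrenceGaussChebyshevBezout

/-!
# Venture HSemireg — **CONSECUTIVE MEMBERS OF A THREE-TERM RECURRENCE WITH UNIT COUPLINGS ARE COPRIME** (ideal-theoretically, any commutative ring): for `q_0 = 1` and
# `q_{n+2} = (X − a_{n+1}) q_{n+1} − b_{n+1} q_n` with every `b_j` a unit, **`IsCoprime q_{n+1} q_n`** (Euclid down the recurrence), so `q_{n+1}`, `q_n` have no common zero in any extension; over a
# field, **`IsCoprime q_{n+2} q_n ⟺ q_n(a_{n+1}) ≠ 0`** (the ideal-theoretic form of N421's criterion, valid for complex zeros too)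

HONEST FRAMING. Part of the Lean index of the computation cell `pub-hsemireg` (seat p10 gen 47, Sunday typer «UNIFORM-IN-n»).  Polynomial algebra only (Mathlib `IsCoprime`); no variety, no
cohomology theory, no sheaf, no Ext group and no semiregularity map is constructed here; nothing here says that HC / HC_CM / HC_AV holds; no Literature fact (unproved `Prop`) is declared or used.
Custodian versions as in `WedgeHankelSiegelIdeal` (1/3).
SOURCES (cited).  G. Szegő, *Orthogonal Polynomials*, §3.3 (3.3.3)–(3.3.5) (consecutive orthogonal polynomials have no common zero; `p_{n+1}`, `p_{n−1}` have opposite signs at the zeros of `p_n`);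
T. S. Chihara, *An Introduction to Orthogonal Polynomials* (1978), Ch. I Thm 5.3; P. C. Gibson, J. Approx. Theory 105 (2000) 129–132 (common zeros two steps apart).  Typed here in ideal-theoretic
form.
PROOF TYPED HERE.  Induction with Mathlib `IsCoprime.add_mul_left_left`, `isCoprime_mul_unit_left_left` (`C(−b)` is a unit); for the gap-two criterion `IsCoprime.add_mul_left_left_iff`,
`IsCoprime.mul_left_iff`, `Irreducible.coprime_iff_not_dvd` (`X − C a`), `dvd_iff_isRoot`.
DEDUP DISCLOSURE (`rg -n 'IsCoprime' Summits/Ventures/HSemireg/WedgeHankelRecurrence*`, 2026-09-04): Bezoutian ∕ Cauchy-index leaves only; N421 `common_zero_gap_two_iff` (real zeros, `b > 0`);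
N446 (Chebyshev instances); 0 hits for the 4 names below.

WHAT IS IN THE TREE.  N421 `common_zero_gap_two_iff`; N446 `chebyshev_isCoprime_T_succ`; Mathlib `IsCoprime` algebra.
THIS FILE (namespace `Summit.Ventures.HSemireg.Wedge.HankelOuter` continued; CHAINED on N446; 0 definitions):
* §1212 **`recurrence_isCoprime_succ`**, `recurrence_eval_succ_ne_zero_of_eval_eq_zero` (no common zero, any nontrivial ring), **`recurrence_isCoprime_gap_two_iff`** (field),
  `recurrence_isCoprime_succ_real` (the chapter's positive real recurrences).
CAVEATS.  Unit couplings (`IsUnit (b j)` for `j ≥ 1`); `q_1` is not constrained (only `q_0 = 1` and the recurrence are used); fields for the gap-two criterion.  Nothing Ext-side.  New names only.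
-/

open Module Polynomial
open scoped Matrix Polynomial

namespace Summit.Ventures.HSemireg.Wedge.HankelOuter

/-! ## §1212. Coprimality along the recurrence -/

/-- **`IsCoprime q_{n+1} q_n`** for a three-term recurrence whose couplings `b_{j+1}` are units (any commutative ring). [Szegő §3.3; Chihara I Thm 5.3; this file, §1212] -/
theorem recurrence_isCoprime_succ {R : Type*} [CommRing R] {q : ℕ → R[X]} {a b : ℕ → R} (hq0 : q 0 = 1)
    (hrec : ∀ n, q (n + 2) = (Polynomial.X - C (a (n + 1))) * q (n + 1) - C (b (n + 1)) * q n) (hb : ∀ j, IsUnit (b (j + 1))) (n : ℕ) :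
    IsCoprime (q (n + 1)) (q n) := by
  induction n with
  | zero => rw [hq0]; exact isCoprime_one_right
  | succ n ih =>
    have hu : IsUnit (C (-b (n + 1))) := Polynomial.isUnit_C.2 (hb n).neg
    have h1 : IsCoprime (C (-b (n + 1)) * q n) (q (n + 1)) := (isCoprime_mul_unit_left_left hu _ _).2 ih.symm
    have h2 := h1.add_mul_left_left (Polynomial.X - C (a (n + 1)))
    have e : C (-b (n + 1)) * q n + q (n + 1) * (Polynomial.X - C (a (n + 1))) = q (n + 2) := by rw [hrec n, map_neg]; ring
    rw [e] at h2
    exact h2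

/-- **No common zero: `q_{n+1}(x) = 0 ⇒ q_n(x) ≠ 0`** in any nontrivial commutative ring (unit couplings). [Szegő (3.3.3); this file, §1212] -/
theorem recurrence_eval_succ_ne_zero_of_eval_eq_zero {R : Type*} [CommRing R] [Nontrivial R] {q : ℕ → R[X]} {a b : ℕ → R} (hq0 : q 0 = 1)
    (hrec : ∀ n, q (n + 2) = (Polynomial.X - C (a (n + 1))) * q (n + 1) - C (b (n + 1)) * q n) (hb : ∀ j, IsUnit (b (j + 1)))
    (n : ℕ) {x : R} (hx : (q (n + 1)).eval x = 0) : (q n).eval x ≠ 0 := by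
  intro h0
  obtain ⟨u, v, huv⟩ := recurrence_isCoprime_succ hq0 hrec hb n
  have e := congrArg (Polynomial.eval x) huv
  rw [eval_add, eval_mul, eval_mul, hx, h0, mul_zero, mul_zero, add_zero, eval_one] at e
  exact zero_ne_one e

/-- **Over a field: `IsCoprime q_{n+2} q_n ⟺ q_n(a_{n+1}) ≠ 0`** (the only possible common factor two steps apart is `X − a_{n+1}`). [Gibson 2000; N421 for real zeros; this file, §1212] -/
theorem recurrence_isCoprime_gap_two_iff {K : Type*} [Field K] {q : ℕ → K[X]} {a b : ℕ → K} (hq0 : q 0 = 1)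
    (hrec : ∀ n, q (n + 2) = (Polynomial.X - C (a (n + 1))) * q (n + 1) - C (b (n + 1)) * q n) (hb : ∀ j, b (j + 1) ≠ 0) (n : ℕ) :
    IsCoprime (q (n + 2)) (q n) ↔ (q n).eval (a (n + 1)) ≠ 0 := by
  have hb' : ∀ j, IsUnit (b (j + 1)) := fun j => isUnit_iff_ne_zero.2 (hb j)
  have h1 : q (n + 2) = (Polynomial.X - C (a (n + 1))) * q (n + 1) + q n * (-C (b (n + 1))) := by rw [hrec n]; ring
  rw [h1, IsCoprime.add_mul_left_left_iff, IsCoprime.mul_left_iff, and_iff_left (recurrence_isCoprime_succ hq0 hrec hb' n),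
    (Polynomial.irreducible_X_sub_C (a (n + 1))).coprime_iff_not_dvd, Polynomial.dvd_iff_isRoot, Polynomial.IsRoot.def]

/-- **The chapter's positive real recurrences: `IsCoprime q_{n+1} q_n` in `ℝ[X]`.** [Szegő §3.3; this file, §1212] -/
theorem recurrence_isCoprime_succ_real {q : ℕ → ℝ[X]} {a b : ℕ → ℝ} (hq0 : q 0 = 1)
    (hrec : ∀ n, q (n + 2) = (Polynomial.X - C (a (n + 1))) * q (n + 1) - C (b (n + 1)) * q n) (hb : ∀ j, 0 < b j) (n : ℕ) : IsCoprime (q (n + 1)) (q n) :=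
  recurrence_isCoprime_succ hq0 hrec (fun j => isUnit_iff_ne_zero.2 (hb (j + 1)).ne') n

end Summit.Ventures.HSemireg.Wedge.HankelOuter
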